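import Summits.BirchSwinnertonDyer.Rank1Residual.X11b.BDPRouteTwistCertificate
import Summits.BirchSwinnertonDyer.Rank1Residual.X11b.BDPRouteCyclotomicCertificate
import Summits.BirchSwinnertonDyer.Rank1Residual.X11b.ChaRoute
import HarnessLib

/-!
# Class X11b, route p2: the twist certificate WITHOUT surjectivity (Cha 2005) and the PER-PAIR
# closure in census columns — `q_d` unit ∧ `p ∤ ∏c(E)` ∧ `p ∤ #Ш(E)_an` ⟹ `BSD(E,p)`, no open input
# (cell `b2b-bsdres`, sub-cell `multr1-p2`, gen 22, file 3)

HONEST FRAMING (cell `b2b-bsdres`, run/shared/lean/b2b/bsd-rank1-residual/, verbatim in every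
file): the goal of the cell is to DELETE the COMBINATION-SHAPED residual classes of the
Birch–Swinnerton-Dyer formula for ALL analytic-rank `≤ 1` elliptic curves over `ℚ` — "full BSD
formula for every rank `≤ 1` curve in class `C`" assembled STRICTLY from published theorems — so
that the rank-`≤ 1` remainder becomes exactly the CONSTRUCTION-SHAPED classes, which are TYPED
(missing-input `Prop`s), NOT attempted. This is not "finishing BSD". Sub-cell `multr1-p2` is a
RESEARCH ROUTE on class X11b (`ClassX11b W p := r_an = 1 ∧ p ≠ 2 ∧ mult(p) ∧ irr(p)`,
`Partition/Rows.lean`); no claim beyond the stated class and loci; X11b's label does not change;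
NOTHING is booked by this file (admissibility of a per-pair closure is the referee's ruling; how a
twist value or `#Ш_an` is certified is lane business).

THEOREMS ONLY (no definition, no named fact, no `sorry`).

WHAT. `X11b/BDPRouteTwistCertificate.lean` (gen 22, file 1) obtains the Euler-system half
`ord_p #Ш(E) ≤ ord_p #Ш(E)_an` on an X11b pair with `p ≥ 5`, `ρ̄_{E,p}` ONTO and `p ∤ ∏_ℓ c_ℓ(E)`
from Kolyvagin 1990 Thm. A (tree fact `Kolyvagin1990_padicValNat_card_sha_le`, whose Galois
hypothesis is surjectivity) and ONE twist certificate (a Heegner field `K`, `d_K < -4`, a globally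
minimal model `Wd` of `E^{d_K}`, its algebraic central value `q_d ≠ 0` with `ord_p q_d = 0`), via the
Gross–Zagier bookkeeping identity `2·ord_p [E(K):ℤP_K] = ord_p #Ш(E)_an + ord_p q_d + ord_p ∏c(E)
+ 2·ord_p #E^{d_K}(ℚ)_tors`. This file:
§1–§2 replace Kolyvagin 1990 by **Cha 2005 Thm. 21** (tree fact
`Cha2005.thm52_padicValNat_shaOrder_le`, as printed by Miller 2011 Thm. 5.2 / GJPST 2009 Thm. 3.5:
`ord_p #Ш(E/ℚ) ≤ 2·ord_p [E(K):ℤ y_K]` for `p` odd, `p ∤ d_K`, `p² ∤ N`, `ρ̄_{E,p}` IRREDUCIBLE,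
`E` non-CM, `r_an ≤ 1`) — every hypothesis of which is AUTOMATIC on X11b at a Heegner field
(`p ∣ N` splits in `K` ⇒ `p ∤ d_K`; multiplicative ⇒ `p² ∤ N_E` and non-CM; `irr(p)` is a field of
the class): the upper half needs NO image hypothesis beyond the class
(`missingUpperBoundAt_of_classX11b_of_twistUnit_of_cha`), so it also holds on the corner
(`ρ̄_{E,p}` irreducible, not onto: 64 ‖ 5 pairs at `p ∈ {5,7}`) wherever `p ∤ ∏c(E)`.
§3 the PER-PAIR CLOSURE WITHOUT THE OPEN INPUT, in the census lane's columns: on X11b ∧ `p ≥ 5` ∧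
`p ∤ ∏c(E)`, a twist certificate and `ord_p #Ш(E)_an ≤ 0` give `BSD(E,p)`
(`bsdp_of_classX11b_of_twistUnit_of_padicValRat_shaAn_le_of_cha`; with `Surj` also `BSD(E^{d_K},p)`,
`bsdp_and_bsdp_twist_of_classX11b_of_twistUnit_of_padicValRat_shaAn_le`). By the identity this is
EXACTLY the Heegner-index certificate of `X11b/ChaRoute.lean` (x11c gen 3: `p ∤ [E(K):ℤy_K]` ∧
`p ∤ #Ш_an`) read through three quantities of `E/ℚ` and `E^{d_K}/ℚ` — `#Ш(E)_an`, `∏c(E)`, `q_d` —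
with NO height computation over `K`. Per pair; nothing booked; X11b stays CONSTRUCTION-SHAPED.
§4 the corner's typed input shrinks: on X11b ∧ `p ≥ 5` ∧ `p ∤ ∏c(E)` a twist certificate and
the MAIN-CONJECTURE half `Typed.MissingLowerBoundAt` already give the whole missing `p`-part
(`missingPPartAt_of_classX11b_of_twistUnit_of_lower_of_cha`) — on the non-split corner pairs the
record's input (T4′) `Typed.MissingPPartAt` is needed only as its lower half.
CENSUS POINTER (EVIDENCE, never a cited fact; kit job j126194 of this seat, PARI `ellL1` via
cypari2 on minimal twist models, seat dir HOME/b2b-bsdres-multr1-p2/tcjob/window/): of the 6 642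
in-window ¬(ram) pairs of the X11b shape (`N < 2·10⁴`, `p ≥ 5`), the 6 473 with `p ∤ ∏c(E)` ALL
carry a unit twist certificate at one of the first eight Heegner discriminants (`|d| ≤ 671`; the
first one in 5 227 cases; all 9 492 evaluated twists have root number `+1` and `#Ш_an(E^d)` a
perfect square to `3·10⁻¹⁴`), and all 6 473 have `p ∤ #Ш_an(E)` in Cremona's table — so §3 applies
to 6 470 surjective pairs and to the 3 non-split corner pairs `3240a1, 5780b1, 6480a1` at `p = 5`
(image `5S4`); the 169 pairs with `p ∣ ∏c(E)` carry none (a unit `q_d` is impossible there: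
`c_q(E^d) = c_q(E)` at the split primes `q ∣ N`). Class-wide run (`2·10⁴ ≤ N < 5·10⁵`, 103 634
pairs): job j126358, numbers in HOME/b2b-bsdres-multr1-p2/REPORT.md §28.
References: [Cha2005] Thm. 21 (p. 173); [Miller2011LMS] Thm. 5.2, Def. 1.1;
[GrigorovJorzaPatrikisSteinTarnita2009] Thm. 3.5; [McCallumLMS1991] §1 Theorem (Kolyvagin), p. 296;
[JetchevSkinnerWan2017] §7.4.1 (eq:gz for K′); [GrossZagier1986] I (6.5), V §2; [Mazur1978] Cor. 4.1;
[SilvermanATAEC1994] II.6.4, IV.10.2; [Carayol1986]; [Miller2011LMS] Def. 1.1.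
-/

noncomputable section

open scoped Classical NumberField

open WeierstrassCurve NumberField IsDedekindDomain Field
open Literature.NumberTheory.EllipticCurves Literature.NumberTheory.EllipticCurves.GreenbergSelmer
  Literature.NumberTheory.EllipticCurves.ModularForms
  Literature.NumberTheory.EllipticCurves.Rank1Residual
  Literature.NumberTheory.EllipticCurves.Rank1Residual.Typed
  Literature.NumberTheory.EllipticCurves.Cha2005
  Literature.NumberTheory.EllipticCurves.KrizLi2019
  Literature.NumberTheory.QuadraticFields.Quadratic
  Literature.NumberTheory.Automorphic
  Literature.NumberTheory.GaloisRepresentations Literature.NumberTheory.GaloisCohomology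

namespace Summit.BirchSwinnertonDyer.Rank1Residual.X11b

/-! ### §1. Datum level, ANY odd `p`, `ρ̄_{E,p}` IRREDUCIBLE: Cha's bound at a unit twist value -/

/-- **Cha's bound read through the Gross–Zagier bookkeeping identity at a UNIT twist value — ANY
odd prime `p`, `ρ̄_{E,p}` irreducible (not necessarily onto), `E` non-CM, `p ∤ d_K`, `p² ∤ N`.**
Data: `W/ℚ` globally minimal with `ord_{s=1} L(E,s) = 1`; `K` imaginary quadratic with the Heegner
hypothesis for the level `N`; `P ∈ E(K)` the Heegner point of a parametrisation datum `Dt` with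
`p ∤ c(Dt)`; `p ∤ #𝓞_K^×`; `Wd = Cd • W^{(d_K)}` globally minimal with `ord_p u(Cd) = 0`;
`p ∤ ∏_ℓ c_ℓ(E)`. CERTIFICATE: `q_d = L(E^{d_K},1)/Ω(Wd) ≠ 0` is a `p`-adic unit. CONCLUSION:
`#Ш(E)_an = q ∈ ℚ`, `ord_p q = 2·ord_p [E(K):ℤP]`, and `ord_p #Ш(E) ≤ 2·ord_p [E(K):ℤP]` — the
Euler-system half `ord_p #Ш(E) ≤ ord_p #Ш(E)_an`. Proof: `exists_shaAn_padicVal_eq_of_heegner`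
(identity; the twist's torsion is prime to `p` by irreducibility), `P` non-torsion (Gross–Zagier,
`L'(E/K,1) ≠ 0`), Cha 2005 Thm. 21 (`hCha`). PUBLISHED binders `hGZ`, `hKo` (finiteness of `Ш`,
qualitative Kolyvagin), `hCha`, `hGZK`, `hmod`; per datum; nothing booked.
[cite: Cha2005, Thm. 21 (p. 173)] [cite: Miller2011LMS, Thm. 5.2 (arXiv:1010.2431 p. 11), Def. 1.1]
[cite: JetchevSkinnerWan2017, §7.4.1 (eq:gz for K′), p. 30] -/
theorem exists_shaAn_padicValNat_shaOrder_le_of_heegner_of_twistUnit_of_cha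
    (W : WeierstrassCurve ℚ) [W.IsElliptic] [W.IsGloballyMinimal] (p : ℕ) [Fact p.Prime]
    (N : ℕ) [NeZero N] (K : Type) [Field K] [NumberField K]
    (Dt : ModularParametrizationData W N) (H : HeegnerDatum N (NumberField.discr K)) (ι : K →+* ℂ)
    (P : (W.baseChange K).toAffine.Point)
    -- the published inputs (named facts of the tree)
    (hGZ : gross_zagier N W K) (hKo : kolyvagin N W K) (hCha : thm52_padicValNat_shaOrder_le)
    (hGZK : rank_eq_analyticRank_of_analyticRank_le_one) (hmod : hasEntireLFunction_rat)
    -- the pair and the Heegner data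
    (hK : IsImaginaryQuadratic K) (hHN : SatisfiesHeegnerHypothesis N K)
    (hP : WeierstrassCurve.Affine.Point.map ι.toRatAlgHom P = heegnerPointComplex Dt H)
    (hp2 : p ≠ 2) (hc : ¬ (p : ℤ) ∣ Dt.c) (hμ : ¬ p ∣ Units.torsionOrder K)
    (hr : W.analyticRank = 1) (hirr : Irr W p) (hcm : ¬ W.HasCM)
    (hpD : ¬ (p : ℤ) ∣ NumberField.discr K) (hpN : ¬ p ^ 2 ∣ N)
    (Wd : WeierstrassCurve ℚ) [Wd.IsElliptic] [Wd.IsGloballyMinimal] (Cd : VariableChange ℚ)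
    (hWd : Cd • W.quadraticTwist (NumberField.discr K : ℚ) = Wd)
    (hu : padicValRat p (Cd.u : ℚ) = 0)
    -- the certificate: the twist's algebraic central value is a `p`-adic unit; `p ∤ ∏c_ℓ(E)`
    (qd : ℚ) (hqd : Wd.entireLFunction 1 / (Wd.realPeriodRat : ℂ) = (qd : ℂ)) (hqd0 : qd ≠ 0)
    (hvd : padicValRat p qd = 0) (htam : ¬ p ∣ W.tamagawaProduct) :
    ∃ q : ℚ, shaAn W = (q : ℂ) ∧
      padicValRat p q = 2 * (padicValNat p (AddSubgroup.zmultiples P).index : ℤ) ∧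
      padicValNat p W.shaOrder ≤ 2 * padicValNat p (AddSubgroup.zmultiples P).index := by
  have hp : p.Prime := Fact.out
  have hD0 : (NumberField.discr K : ℚ) ≠ 0 := by exact_mod_cast NumberField.discr_ne_zero K
  haveI hEt : (W.quadraticTwist (NumberField.discr K : ℚ)).IsElliptic :=
    W.isElliptic_quadraticTwist hD0
  -- the twist's central value is non-zero
  have hLt' : (W.quadraticTwist (NumberField.discr K : ℚ)).entireLFunction = Wd.entireLFunction := by
    rw [← hWd, entireLFunction_smul]
  have hLt : (W.quadraticTwist (NumberField.discr K : ℚ)).entireLFunction 1 ≠ 0 := by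
    rw [hLt']
    intro h0
    apply hqd0
    have : ((qd : ℂ)) = 0 := by rw [← hqd, h0, zero_div]
    exact_mod_cast this
  -- the twist has no rational `p`-torsion
  have hirrd : Wd.HasIrreducibleModPGaloisRep p :=
    hasIrreducibleModPGaloisRep_twist_model W p K hK.1 hirr Cd hWd
  have htors : padicValNat p Wd.torsionOrder = 0 :=
    padicValNat_torsionOrder_eq_zero_of_irreducible Wd p hirrd
  -- the identity
  obtain ⟨-, -, -, q, hq, hid⟩ :=
    exists_shaAn_padicVal_eq_of_heegner W p N K Dt H ι P hGZ hKo hGZK hmod hK hHN hP hp2 hc hμ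
      hr hLt Wd Cd hWd hu qd hqd
  rw [hvd, htors, padicValNat.eq_zero_of_not_dvd htam] at hid
  have hvq : padicValRat p q = 2 * (padicValNat p (AddSubgroup.zmultiples P).index : ℤ) := by
    have := hid; push_cast at this ⊢; linarith
  -- the Heegner point is non-torsion; Cha's bound
  have hPH : IsHeegnerPoint N W K P := ⟨Dt, H, ι, hP⟩
  have hL0 : W.entireLFunction 1 = 0 := entireLFunction_one_eq_zero_of_analyticRank_eq_one hr
  obtain ⟨-, hderiv⟩ := leadingLCoeff_eq_deriv_of_analyticRank_eq_one hr
  have hLK : LDerivEK W K ≠ 0 := by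
    rw [lDerivEK_eq_deriv_mul W K hmod hL0]
    exact mul_ne_zero hderiv hLt
  have hnt : ¬ IsOfFinAddOrder P :=
    (lDerivEK_ne_zero_iff_not_isOfFinAddOrder W N K hGZ hK hHN hPH).mp hLK
  exact ⟨q, hq, hvq, hCha W N K hK hHN P hPH hnt p hcm hp2 hpD hpN hirr hr.le⟩

/-! ### §2. Class X11b, `p ≥ 5`, NO surjectivity: the Euler-system half from ONE twist certificate -/

section Pair

variable (W : WeierstrassCurve ℚ) [W.IsElliptic] [W.IsGloballyMinimal] (p : ℕ) [Fact p.Prime]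

/-- **X11b ∧ `p ≥ 5` ∧ `p ∤ ∏_ℓ c_ℓ(E)` — NO image hypothesis beyond `irr(p)` — at a GIVEN Heegner
field `K` with `d_K < -4` and a unit twist value: `#Ш(E)_an = q ∈ ℚ` with `ord_p #Ш(E) ≤ ord_p q`.**
Every hypothesis of Cha's theorem is DISCHARGED from the class and the Heegner hypothesis:
`p ∤ d_K` (`p ∣ N_E` splits in `K`: `not_dvd_discr_of_satisfiesHeegnerHypothesis`), `p² ∤ N_E`
(multiplicative: `not_sq_dvd_conductorNorm_of_mult`), non-CM (a CM curve has no multiplicative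
prime: `not_mult_of_hasCM`); the parametrisation datum with `p ∤ c` comes from modularity + Mazur
1978 Cor. 4.1 (`exists_maninDatum`), `ord_p u(Cd) = 0` for ANY globally minimal twist model
(`padicValRat_u_eq_zero_of_twist_minimal`), `#𝓞_K^× = 2`. PUBLISHED binders: Gross–Zagier,
Kolyvagin (qualitative, `hKo`), Cha 2005 (`hCha`), GZK, modularity ×2, Mazur 1978 Cor. 4.1. Per pair;
nothing booked. [cite: Cha2005, Thm. 21 (p. 173)] [cite: Miller2011LMS, Thm. 5.2, Def. 1.1]
[cite: JetchevSkinnerWan2017, §7.4.1 (eq:gz for K′), p. 30] [cite: Mazur1978, Cor. 4.1]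
[cite: SilvermanATAEC1994, Thm. II.6.4, IV.10.2 (c)] -/
theorem exists_shaAn_padicValNat_shaOrder_le_of_classX11b_of_twistUnit_of_cha
    (hGZ : ∀ (N : ℕ) [NeZero N] (W : WeierstrassCurve ℚ) (K : Type) [Field K] [NumberField K],
      gross_zagier N W K)
    (hKo : ∀ (N : ℕ) [NeZero N] (W : WeierstrassCurve ℚ) (K : Type) [Field K] [NumberField K],
      kolyvagin N W K)
    (hCha : thm52_padicValNat_shaOrder_le)
    (hGZK : rank_eq_analyticRank_of_analyticRank_le_one) (hmod : hasEntireLFunction_rat)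
    (hnf : exists_isNewformOf) (hMaz : mazur_not_dvd_maninConstant_of_odd)
    -- the pair: X11b, `p ≥ 5`, `p ∤ ∏c` (NO surjectivity)
    (hX : ClassX11b W p) (hp5 : 5 ≤ p) (htam : ¬ p ∣ W.tamagawaProduct)
    -- the certificate: a Heegner field, a minimal model of the twist, its unit central value
    (K : Type) [Field K] [NumberField K] (hK : IsImaginaryQuadratic K)
    (hHN : SatisfiesHeegnerHypothesis (W.conductorNorm ℤ) K) (hdK : NumberField.discr K < -4)
    (Wd : WeierstrassCurve ℚ) [Wd.IsElliptic] [Wd.IsGloballyMinimal] (Cd : VariableChange ℚ)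
    (hWd : Cd • W.quadraticTwist (NumberField.discr K : ℚ) = Wd)
    (qd : ℚ) (hqd : Wd.entireLFunction 1 / (Wd.realPeriodRat : ℂ) = (qd : ℂ)) (hqd0 : qd ≠ 0)
    (hvd : padicValRat p qd = 0) :
    ∃ q : ℚ, shaAn W = (q : ℂ) ∧ (padicValNat p W.shaOrder : ℤ) ≤ padicValRat p q := by
  have hp : p.Prime := Fact.out
  obtain ⟨hr, hp2, hmult, hirr⟩ := hX
  haveI : NeZero (W.conductorNorm ℤ) := ⟨(W.conductorNorm_pos_holds).ne'⟩
  -- `w_K = 2`, prime to `p`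
  have hμ : ¬ p ∣ Units.torsionOrder K := by
    rw [Literature.NumberTheory.DiophantineGeometry.torsionOrder_eq_two_of_discr_lt hK.1 hdK]
    intro h2
    have := Nat.le_of_dvd two_pos h2
    omega
  -- Cha's hypotheses from the class: non-CM, `p ∤ d_K`, `p² ∤ N_E`
  have hcm : ¬ W.HasCM := fun hCM ↦ not_mult_of_hasCM W hCM p hmult
  have hpD : ¬ (p : ℤ) ∣ NumberField.discr K :=
    not_dvd_discr_of_satisfiesHeegnerHypothesis hK hHN hp (dvd_conductorNorm_of_mult hmult)
  have hpN : ¬ p ^ 2 ∣ W.conductorNorm ℤ := not_sq_dvd_conductorNorm_of_mult W p hmult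
  -- the Heegner datum with `p ∤ c` (modularity, Mazur 1978 Cor. 4.1, Néron mapping property)
  obtain ⟨Dt, H, ι, P, hP, hc⟩ :=
    exists_maninDatum hnf hMaz integral_neronScaling_of_isGloballyMinimal_holds W p
      (W.conductorNorm ℤ) K rfl hp5 hmult hirr hK hHN
  -- the minimal twist model differs by a `p`-unit (`p ∣ N` splits in `K`)
  have hu : padicValRat p (Cd.u : ℚ) = 0 :=
    padicValRat_u_eq_zero_of_twist_minimal W p K hK hHN hmult Cd hWd
  obtain ⟨q, hq, hvq, hle⟩ :=
    exists_shaAn_padicValNat_shaOrder_le_of_heegner_of_twistUnit_of_cha W p (W.conductorNorm ℤ) K Dt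
      H ι P (hGZ _ W K) (hKo _ W K) hCha hGZK hmod hK hHN hP hp2 hc hμ hr hirr hcm hpD hpN Wd Cd hWd
      hu qd hqd hqd0 hvd htam
  refine ⟨q, hq, ?_⟩
  rw [hvq]
  exact_mod_cast hle

/-- **The Euler-system half `ord_p #Ш(E) ≤ ord_p #Ш(E)_an` on X11b ∧ `p ≥ 5` ∧ `p ∤ ∏_ℓ c_ℓ(E)`
from ONE twist certificate, with NO surjectivity** — the typed output `Typed.MissingUpperBoundAt W p`
from PUBLISHED facts (Cha 2005 in place of Kolyvagin 1990) and the certificate `(K, Wd, q_d)`. In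
particular it holds on the non-surjective corner of X11b (`ρ̄_{E,p}` irreducible with image `5S4` /
`5Ns` / `7Ns`, 64 ‖ 5 pairs) wherever `p ∤ ∏c(E)` — where neither Kato's surjective divisibility nor
Kolyvagin 1990 applies. Per pair; nothing booked. [cite: Cha2005, Thm. 21 (p. 173)]
[cite: Miller2011LMS, Thm. 5.2, Def. 1.1] [cite: JetchevSkinnerWan2017, §7.4.1 (p. 30)] -/
theorem missingUpperBoundAt_of_classX11b_of_twistUnit_of_cha
    (hGZ : ∀ (N : ℕ) [NeZero N] (W : WeierstrassCurve ℚ) (K : Type) [Field K] [NumberField K],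
      gross_zagier N W K)
    (hKo : ∀ (N : ℕ) [NeZero N] (W : WeierstrassCurve ℚ) (K : Type) [Field K] [NumberField K],
      kolyvagin N W K)
    (hCha : thm52_padicValNat_shaOrder_le)
    (hGZK : rank_eq_analyticRank_of_analyticRank_le_one) (hmod : hasEntireLFunction_rat)
    (hnf : exists_isNewformOf) (hMaz : mazur_not_dvd_maninConstant_of_odd)
    (hX : ClassX11b W p) (hp5 : 5 ≤ p) (htam : ¬ p ∣ W.tamagawaProduct)
    (K : Type) [Field K] [NumberField K] (hK : IsImaginaryQuadratic K)
    (hHN : SatisfiesHeegnerHypothesis (W.conductorNorm ℤ) K) (hdK : NumberField.discr K < -4)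
    (Wd : WeierstrassCurve ℚ) [Wd.IsElliptic] [Wd.IsGloballyMinimal] (Cd : VariableChange ℚ)
    (hWd : Cd • W.quadraticTwist (NumberField.discr K : ℚ) = Wd)
    (qd : ℚ) (hqd : Wd.entireLFunction 1 / (Wd.realPeriodRat : ℂ) = (qd : ℂ)) (hqd0 : qd ≠ 0)
    (hvd : padicValRat p qd = 0) :
    Typed.MissingUpperBoundAt W p :=
  exists_shaAn_padicValNat_shaOrder_le_of_classX11b_of_twistUnit_of_cha W p hGZ hKo hCha hGZK hmod
    hnf hMaz hX hp5 htam K hK hHN hdK Wd Cd hWd qd hqd hqd0 hvd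

/-! ### §3. The per-pair closure WITHOUT the open input: twist certificate + `ord_p #Ш(E)_an ≤ 0` -/

/-- **PER-PAIR CLOSURE in census columns, NO surjectivity, NO open input, NO regulator.** On X11b ∧
`p ≥ 5` ∧ `p ∤ ∏_ℓ c_ℓ(E)`: a twist certificate `(K, Wd, q_d)` (`d_K < -4`, `q_d ≠ 0`,
`ord_p q_d = 0`) and `ord_p #Ш(E)_an ≤ 0` (for ANY rational `s` with `#Ш(E)_an = s`) give `BSD(E,p)`:
`0 ≤ ord_p #Ш(E) ≤ ord_p #Ш(E)_an ≤ 0`. By the Gross–Zagier identity the hypotheses say exactly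
`p ∤ [E(K):ℤP_K]` — this is the Heegner-index certificate of `X11b/ChaRoute.lean`
(`ClassX11b.bsdp_of_chaCertificate_of_carayol`) with the index replaced by the three rational
quantities `#Ш(E)_an`, `∏c(E)`, `q_d` (no height over `K`). Applies verbatim on the corner. Per
pair; nothing booked; X11b's label unchanged. [cite: Cha2005, Thm. 21 (p. 173)]
[cite: Miller2011LMS, Thm. 5.2, Def. 1.1 and Prop. 7.6] [cite: JetchevSkinnerWan2017, §7.4.1 (p. 30)] -/
theorem bsdp_of_classX11b_of_twistUnit_of_padicValRat_shaAn_le_of_cha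
    (hGZ : ∀ (N : ℕ) [NeZero N] (W : WeierstrassCurve ℚ) (K : Type) [Field K] [NumberField K],
      gross_zagier N W K)
    (hKo : ∀ (N : ℕ) [NeZero N] (W : WeierstrassCurve ℚ) (K : Type) [Field K] [NumberField K],
      kolyvagin N W K)
    (hCha : thm52_padicValNat_shaOrder_le)
    (hGZK : rank_eq_analyticRank_of_analyticRank_le_one) (hmod : hasEntireLFunction_rat)
    (hnf : exists_isNewformOf) (hMaz : mazur_not_dvd_maninConstant_of_odd)
    (hX : ClassX11b W p) (hp5 : 5 ≤ p) (htam : ¬ p ∣ W.tamagawaProduct)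
    (K : Type) [Field K] [NumberField K] (hK : IsImaginaryQuadratic K)
    (hHN : SatisfiesHeegnerHypothesis (W.conductorNorm ℤ) K) (hdK : NumberField.discr K < -4)
    (Wd : WeierstrassCurve ℚ) [Wd.IsElliptic] [Wd.IsGloballyMinimal] (Cd : VariableChange ℚ)
    (hWd : Cd • W.quadraticTwist (NumberField.discr K : ℚ) = Wd)
    (qd : ℚ) (hqd : Wd.entireLFunction 1 / (Wd.realPeriodRat : ℂ) = (qd : ℂ)) (hqd0 : qd ≠ 0)
    (hvd : padicValRat p qd = 0)
    {s : ℚ} (hs : shaAn W = (s : ℂ)) (hv : padicValRat p s ≤ 0) : BSDp W p := by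
  obtain ⟨q, hq, hle⟩ := exists_shaAn_padicValNat_shaOrder_le_of_classX11b_of_twistUnit_of_cha W p
    hGZ hKo hCha hGZK hmod hnf hMaz hX hp5 htam K hK hHN hdK Wd Cd hWd qd hqd hqd0 hvd
  have hqs : q = s := by exact_mod_cast hq.symm.trans hs
  subst hqs
  exact bsdp_of_upper_of_padicValRat_shaAn_le W p hGZK (by rw [hX.1]) hq hle hv

/-- **PER-PAIR CLOSURE with surjectivity (Kolyvagin 1990 instead of Cha): `BSD(E,p)` AND
`BSD(E^{d_K},p)`.** On X11b ∧ `p ≥ 5` ∧ `ρ̄_{E,p}` onto ∧ `p ∤ ∏_ℓ c_ℓ(E)`, a twist certificate and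
`ord_p #Ш(E)_an ≤ 0` give `ord_p #Ш(E) = ord_p #Ш(E)_an = 0` and `ord_p #Ш(E^{d_K}) = 0` (gen 22
file 1, §2: `ord_p #Ш(E) + ord_p #Ш(Wd) ≤ ord_p #Ш(E)_an`), hence `BSD(E,p)` and — by the rank-zero
print shape for the twist (`p ∤ ∏c(Wd)` by the Tamagawa transport at a Heegner field, no rational
`p`-torsion by irreducibility) — `BSD(Wd,p)`. NO open input, NO regulator, NO (ram), NO sign
condition at `p`. Per pair; nothing booked. [cite: McCallumLMS1991, §1 Theorem (Kolyvagin), p. 296]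
[cite: Miller2011LMS, Def. 1.1 and Prop. 7.6] [cite: JetchevSkinnerWan2017, §7.4.1 (p. 30)] -/
theorem bsdp_and_bsdp_twist_of_classX11b_of_twistUnit_of_padicValRat_shaAn_le
    (hGZ : ∀ (N : ℕ) [NeZero N] (W : WeierstrassCurve ℚ) (K : Type) [Field K] [NumberField K],
      gross_zagier N W K)
    (hKo : ∀ (N : ℕ) [NeZero N] (W : WeierstrassCurve ℚ) (K : Type) [Field K] [NumberField K],
      kolyvagin N W K)
    (hB : ∀ (N : ℕ) [NeZero N] (W : WeierstrassCurve ℚ) (K : Type) [Field K] [NumberField K],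
      Kolyvagin1990_padicValNat_card_sha_le N W K)
    (hGZK : rank_eq_analyticRank_of_analyticRank_le_one) (hmod : hasEntireLFunction_rat)
    (hnf : exists_isNewformOf) (hMaz : mazur_not_dvd_maninConstant_of_odd)
    (hX : ClassX11b W p) (hp5 : 5 ≤ p) (hsurj : Surj W p) (htam : ¬ p ∣ W.tamagawaProduct)
    (K : Type) [Field K] [NumberField K] (hK : IsImaginaryQuadratic K)
    (hHN : SatisfiesHeegnerHypothesis (W.conductorNorm ℤ) K) (hdK : NumberField.discr K < -4)
    (Wd : WeierstrassCurve ℚ) [Wd.IsElliptic] [Wd.IsGloballyMinimal] (Cd : VariableChange ℚ)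
    (hWd : Cd • W.quadraticTwist (NumberField.discr K : ℚ) = Wd)
    (qd : ℚ) (hqd : Wd.entireLFunction 1 / (Wd.realPeriodRat : ℂ) = (qd : ℂ)) (hqd0 : qd ≠ 0)
    (hvd : padicValRat p qd = 0)
    {s : ℚ} (hs : shaAn W = (s : ℂ)) (hv : padicValRat p s ≤ 0) : BSDp W p ∧ BSDp Wd p := by
  obtain ⟨q, hq, hle⟩ := exists_shaAn_padicValNat_shaOrder_add_le_of_classX11b_of_twistUnit W p
    hGZ hKo hB hGZK hmod hnf hMaz hX hp5 hsurj htam K hK hHN hdK Wd Cd hWd qd hqd hqd0 hvd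
  have hqs : q = s := by exact_mod_cast hq.symm.trans hs
  subst hqs
  have h0 : (0 : ℤ) ≤ padicValNat p Wd.shaOrder := by exact_mod_cast Nat.zero_le _
  have h0' : (0 : ℤ) ≤ padicValNat p W.shaOrder := by exact_mod_cast Nat.zero_le _
  have hshad : padicValNat p Wd.shaOrder = 0 := by
    have : (padicValNat p Wd.shaOrder : ℤ) ≤ 0 := by linarith
    omega
  refine ⟨bsdp_of_upper_of_padicValRat_shaAn_le W p hGZK (by rw [hX.1]) hq (by linarith) hv, ?_⟩
  ---------------------------------------------------------------- the twist (rank zero)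
  obtain ⟨hr, hp2, hmult, hirr⟩ := hX
  have hD0 : (NumberField.discr K : ℚ) ≠ 0 := by exact_mod_cast NumberField.discr_ne_zero K
  haveI hEt : (W.quadraticTwist (NumberField.discr K : ℚ)).IsElliptic :=
    W.isElliptic_quadraticTwist hD0
  have hLt' : (W.quadraticTwist (NumberField.discr K : ℚ)).entireLFunction = Wd.entireLFunction := by
    rw [← hWd, entireLFunction_smul]
  have hLd1 : Wd.entireLFunction 1 ≠ 0 := by
    intro h0''
    apply hqd0
    have : ((qd : ℂ)) = 0 := by rw [← hqd, h0'', zero_div]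
    exact_mod_cast this
  have hrd : Wd.analyticRank = 0 := (Wd.analyticRank_eq_zero_iff_holds (hmod Wd)).2 hLd1
  have hirrd : Wd.HasIrreducibleModPGaloisRep p :=
    hasIrreducibleModPGaloisRep_twist_model W p K hK.1 hirr Cd hWd
  have htors : padicValNat p Wd.torsionOrder = 0 :=
    padicValNat_torsionOrder_eq_zero_of_irreducible Wd p hirrd
  have htamd : padicValNat p Wd.tamagawaProduct = 0 := by
    rw [padicValNat_tamagawaProduct_twist_of_heegner W p hp5 K hK hHN Cd hWd]
    exact padicValNat.eq_zero_of_not_dvd htam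
  refine bsdp_of_pPartRankZero Wd p hmod hGZK hrd ⟨qd, hqd, ?_⟩
  rw [hvd, hshad, htamd, htors]
  simp

/-! ### §4. The corner's typed input shrinks to its main-conjecture half -/

/-- **On X11b ∧ `p ≥ 5` ∧ `p ∤ ∏_ℓ c_ℓ(E)` (NO surjectivity), a twist certificate and the
main-conjecture half `ord_p #Ш(E)_an ≤ ord_p #Ш(E)` give the whole missing `p`-part
`ord_p #Ш(E) = ord_p #Ш(E)_an`.** On the non-surjective corner of X11b (64 ‖ 5 pairs, typed in the
records by (T4′) `Typed.MissingPPartAt`) with `p ∤ ∏c(E)` this leaves ONLY the lower half to be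
typed. Per pair; nothing booked; labels unchanged. [cite: Cha2005, Thm. 21 (p. 173)]
[cite: Miller2011LMS, Thm. 5.2, Def. 1.1] [cite: JetchevSkinnerWan2017, §7.4.1 (p. 30)] -/
theorem missingPPartAt_of_classX11b_of_twistUnit_of_lower_of_cha
    (hGZ : ∀ (N : ℕ) [NeZero N] (W : WeierstrassCurve ℚ) (K : Type) [Field K] [NumberField K],
      gross_zagier N W K)
    (hKo : ∀ (N : ℕ) [NeZero N] (W : WeierstrassCurve ℚ) (K : Type) [Field K] [NumberField K],
      kolyvagin N W K)
    (hCha : thm52_padicValNat_shaOrder_le)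
    (hGZK : rank_eq_analyticRank_of_analyticRank_le_one) (hmod : hasEntireLFunction_rat)
    (hnf : exists_isNewformOf) (hMaz : mazur_not_dvd_maninConstant_of_odd)
    (hX : ClassX11b W p) (hp5 : 5 ≤ p) (htam : ¬ p ∣ W.tamagawaProduct)
    (K : Type) [Field K] [NumberField K] (hK : IsImaginaryQuadratic K)
    (hHN : SatisfiesHeegnerHypothesis (W.conductorNorm ℤ) K) (hdK : NumberField.discr K < -4)
    (Wd : WeierstrassCurve ℚ) [Wd.IsElliptic] [Wd.IsGloballyMinimal] (Cd : VariableChange ℚ)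
    (hWd : Cd • W.quadraticTwist (NumberField.discr K : ℚ) = Wd)
    (qd : ℚ) (hqd : Wd.entireLFunction 1 / (Wd.realPeriodRat : ℂ) = (qd : ℂ)) (hqd0 : qd ≠ 0)
    (hvd : padicValRat p qd = 0) (hl : Typed.MissingLowerBoundAt W p) :
    Typed.MissingPPartAt W p ∧ BSDp W p := by
  have hpp : Typed.MissingPPartAt W p :=
    Typed.missingPPartAt_of_lower_of_upper W p hl
      (missingUpperBoundAt_of_classX11b_of_twistUnit_of_cha W p hGZ hKo hCha hGZK hmod hnf hMaz hX hp5
        htam K hK hHN hdK Wd Cd hWd qd hqd hqd0 hvd)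
  exact ⟨hpp, Typed.bsdp_of_missingPPartAt W p hGZK (by rw [hX.1]) hpp⟩

end Pair

end Summit.BirchSwinnertonDyer.Rank1Residual.X11b

end
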